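import Summits.CriticalPhenomena.PercolationContinuityZ3.Theorems.PercNearOneGluingNoHeavyLowerTailStarSetAggregation
import HarnessLib

/-!
# `NoHeavyLowerTail` (stmt-CriticalPhenomena-4575) — accounting of the swap family: credit charge and overflow streams (U1-PROOF.md §5; blueprint B5c/F3)

Support file (prover `prim-gen-swap` gen 13; `--supports stmt-CriticalPhenomena-4575`).  No definitions, no named facts, no sorries.

The Φ family of the charging scheme (U1-PROOF.md §5, LEAN-BLUEPRINT-U1.md §C (Φ), §F3).  A credit configuration `ω′ = Z ∪ {A(d)}` is the target of at
most two units `(Z ∪ {X}, X)`, `(Z ∪ {X′}, X′)` (`swap_fibre_card_le_two`, `swap_targets_one_port`), each of weight `≤ W(ω′)` (`swap_weight_ge`).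
SYMMETRIC OVERFLOW (F3): when there are two, each sends half of `min(W(Z∪{X}), W(Z∪{X′}))` to the triangle word of `Δ = {X, X′, Y}` (`Y` the class
of `Z` avoiding `d`), the rest to `ω′`; the charge on `ω′` is then `max ≤ W(ω′)`, and for fixed `(Δ, d)` the overflow stream over all `Z ∋ Y` is at most
`min(θ_Xθ_Y, θ_X′θ_Y) ≤ cap(B Δ)/8` (L5.3), three vertices `d` giving the ledger coefficient `3/8`.

* `StarSet.swap_pair_charge_le` — `a, b ≤ c ⇒ a + b − min a b ≤ c`;
* `StarSet.overflow_stream_le` — `Σ_Z min(W(Z∪{X}), W(Z∪{X′})) ≤ min(θ_Xθ_Y, θ_X′θ_Y)` over distinct `Z ∋ Y` avoiding `X, X′`;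
* `StarSet.min_le_of_mul_le_sq` — `p ≥ 0`, `ab ≤ p²` ⇒ `min a b ≤ p`;
* `StarSet.overflow_word_cap_ge` — `8·min(θ_X, θ_X′)·θ_Y ≤ Π O(rotation 1) + Π O(rotation 2)` for the triangle `{X, X′, Y}`.
-/

namespace Summit.CriticalPhenomena.PercolationContinuityZ3.Theorems

open Finset
open scoped BigOperators

namespace StarSet

variable {ι : Type*} [Fintype ι] [DecidableEq ι]

omit [Fintype ι] [DecidableEq ι] in
/-- Two demands each within the capacity, minus their overlap `min`, fit: `a + b − min a b = max a b ≤ c`. -/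
theorem swap_pair_charge_le (a b c : ℝ) (ha : a ≤ c) (hb : b ≤ c) : a + b - min a b ≤ c := by
  rcases le_total a b with h | h
  · rw [min_eq_left h]; linarith
  · rw [min_eq_right h]; linarith

/-- **Overflow stream of a triangle vertex (U1-PROOF L5.3 with F3): `Σ_Z min(W(Z∪{X}), W(Z∪{X′})) ≤ min(θ_Xθ_Y, θ_X′θ_Y)`** over a family of
pairwise distinct rider sets `Z` containing `Y` and avoiding `X, X′` (`X, X′, Y` distinct). -/
theorem overflow_stream_le (θ : ι → ℝ) (hθ0 : ∀ i, 0 ≤ θ i) (hθ1 : ∀ i, θ i ≤ 1) {X X' Y : ι} (hXY : X ≠ Y) (hX'Y : X' ≠ Y)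
    (𝒵 : Finset (Finset ι)) (h𝒵 : ∀ Z ∈ 𝒵, Y ∈ Z ∧ X ∉ Z ∧ X' ∉ Z) :
    ∑ Z ∈ 𝒵, min ((∏ k ∈ insert X Z, θ k) * ∏ k ∈ univ \ insert X Z, (1 - θ k))
        ((∏ k ∈ insert X' Z, θ k) * ∏ k ∈ univ \ insert X' Z, (1 - θ k)) ≤ min (θ X * θ Y) (θ X' * θ Y) := by
  classical
  -- each single stream is a cylinder bound after the injective map `Z ↦ Z ∪ {H}`
  have hstream : ∀ H : ι, H ≠ Y → (∀ Z ∈ 𝒵, Y ∈ Z ∧ H ∉ Z) →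
      ∑ Z ∈ 𝒵, ((∏ k ∈ insert H Z, θ k) * ∏ k ∈ univ \ insert H Z, (1 - θ k)) ≤ θ H * θ Y := by
    intro H hHY hZ
    have hinj : Set.InjOn (fun Z : Finset ι => insert H Z) ↑𝒵 := by
      intro Z hZm Z' hZ'm h
      have h1 := (hZ Z hZm).2
      have h2 := (hZ Z' hZ'm).2
      simp only at h
      rw [← erase_insert h1, ← erase_insert h2, h]
    rw [← sum_image (f := fun S : Finset ι => (∏ k ∈ S, θ k) * ∏ k ∈ univ \ S, (1 - θ k)) hinj]
    set C := 𝒵.image (fun Z : Finset ι => insert H Z) with hC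
    have h := weighted_sum_le_pair θ hθ0 hθ1 hHY (fun S => if S ∈ C then (1 : ℝ) else 0)
      (fun S => by by_cases h : S ∈ C <;> simp [h]) (fun S hS => by
        by_cases h : S ∈ C
        · obtain ⟨Z, hZm, rfl⟩ := mem_image.1 h
          exact ⟨mem_insert_self H Z, mem_insert_of_mem (hZ Z hZm).1⟩
        · simp [h] at hS)
    have hsub : C ⊆ (univ : Finset ι).powerset := fun S _ => mem_powerset.2 (subset_univ S)
    simp_rw [mul_boole] at h
    rw [sum_ite_mem, inter_eq_right.2 hsub] at h
    exact h
  have h1 : ∑ Z ∈ 𝒵, min ((∏ k ∈ insert X Z, θ k) * ∏ k ∈ univ \ insert X Z, (1 - θ k))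
      ((∏ k ∈ insert X' Z, θ k) * ∏ k ∈ univ \ insert X' Z, (1 - θ k)) ≤ θ X * θ Y :=
    (sum_le_sum fun Z _ => min_le_left _ _).trans (hstream X hXY fun Z hZ => ⟨(h𝒵 Z hZ).1, (h𝒵 Z hZ).2.1⟩)
  have h2 : ∑ Z ∈ 𝒵, min ((∏ k ∈ insert X Z, θ k) * ∏ k ∈ univ \ insert X Z, (1 - θ k))
      ((∏ k ∈ insert X' Z, θ k) * ∏ k ∈ univ \ insert X' Z, (1 - θ k)) ≤ θ X' * θ Y :=
    (sum_le_sum fun Z _ => min_le_right _ _).trans (hstream X' hX'Y fun Z hZ => ⟨(h𝒵 Z hZ).1, (h𝒵 Z hZ).2.2⟩)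
  exact le_min h1 h2

omit [Fintype ι] [DecidableEq ι] in
/-- `p ≥ 0` and `ab ≤ p²` give `min a b ≤ p`. -/
theorem min_le_of_mul_le_sq (a b p : ℝ) (hp : 0 ≤ p) (h : a * b ≤ p ^ 2) : min a b ≤ p := by
  by_contra hlt
  rw [not_le] at hlt
  have ha' : p < a := hlt.trans_le (min_le_left a b)
  have hb' : p < b := hlt.trans_le (min_le_right a b)
  have : p ^ 2 < a * b := by
    calc p ^ 2 = p * p := sq p
      _ ≤ a * p := mul_le_mul_of_nonneg_right ha'.le hp
      _ < a * b := mul_lt_mul_of_pos_left hb' (hp.trans_lt ha')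
  linarith

omit [Fintype ι] [DecidableEq ι] in
/-- **Capacity of the overflow word (U1-PROOF L5.3): `8·min(θ_X,θ_X′)·θ_Y ≤ Π O(rotation 1) + Π O(rotation 2)`** for the triangle `{X, X′, Y}`
with complementary designations, `O_{·,P}O_{·,P'} ≥ Φ²`, `Φ² ≥ θ` for `X, X′` and `Φ_Y ≥ 4θ_Y`. -/
theorem overflow_word_cap_ge (θX θX' θY ΦX ΦX' ΦY OX OX₂ OX' OX'₂ OY OY₂ : ℝ)
    (hθX : 0 ≤ θX) (hθX' : 0 ≤ θX') (hθY : 0 ≤ θY) (hΦX0 : 0 ≤ ΦX) (hΦX'0 : 0 ≤ ΦX') (hΦY : 4 * θY ≤ ΦY)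
    (hXsq : θX ≤ ΦX ^ 2) (hX'sq : θX' ≤ ΦX' ^ 2)
    (hOX : 0 ≤ OX) (hOX₂ : 0 ≤ OX₂) (hOX' : 0 ≤ OX') (hOX'₂ : 0 ≤ OX'₂) (hOY : 0 ≤ OY) (hOY₂ : 0 ≤ OY₂)
    (hX : ΦX ^ 2 ≤ OX * OX₂) (hX' : ΦX' ^ 2 ≤ OX' * OX'₂) (hY : ΦY ^ 2 ≤ OY * OY₂) :
    8 * (min θX θX' * θY) ≤ OX * OX' * OY + OX₂ * OX'₂ * OY₂ := by
  have hΦY0 : 0 ≤ ΦY := by linarith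
  -- `min(θX, θX′) ≤ ΦX ΦX′`
  have hmin : min θX θX' ≤ ΦX * ΦX' := by
    refine min_le_of_mul_le_sq θX θX' (ΦX * ΦX') (mul_nonneg hΦX0 hΦX'0) ?_
    have := mul_le_mul hXsq hX'sq hθX' (sq_nonneg _)
    nlinarith
  -- `2 ΦX ΦX′ ΦY ≤ cap`
  have h12 : (ΦX * ΦX') ^ 2 ≤ (OX * OX') * (OX₂ * OX'₂) := by
    have := mul_le_mul hX hX' (sq_nonneg _) (mul_nonneg hOX hOX₂)
    nlinarith
  have h123 : (ΦX * ΦX' * ΦY) ^ 2 ≤ (OX * OX' * OY) * (OX₂ * OX'₂ * OY₂) := by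
    have := mul_le_mul h12 hY (sq_nonneg _) (mul_nonneg (mul_nonneg hOX hOX') (mul_nonneg hOX₂ hOX'₂))
    nlinarith
  have hamgm : 2 * (ΦX * ΦX' * ΦY) ≤ OX * OX' * OY + OX₂ * OX'₂ * OY₂ := by
    nlinarith [sq_nonneg (OX * OX' * OY - OX₂ * OX'₂ * OY₂), sq_nonneg (OX * OX' * OY + OX₂ * OX'₂ * OY₂ - 2 * (ΦX * ΦX' * ΦY)),
      mul_nonneg (mul_nonneg hOX hOX') hOY, mul_nonneg (mul_nonneg hOX₂ hOX'₂) hOY₂]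
  have hmin0 : 0 ≤ min θX θX' := le_min hθX hθX'
  have h4 : 4 * (min θX θX' * θY) ≤ ΦX * ΦX' * ΦY := by
    have := mul_le_mul hmin hΦY (by linarith) (mul_nonneg hΦX0 hΦX'0)
    nlinarith
  linarith

end StarSet

end Summit.CriticalPhenomena.PercolationContinuityZ3.Theorems
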